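import Literature.Algebra.EuclideanLattices.DualLattice
import Mathlib.Analysis.SpecialFunctions.Trigonometric.Bounds
import Mathlib.Topology.Algebra.Group.Basic
import HarnessLib

/-!
# Soundness of the Aharonov–Regev witness test used in MR07 Thm. 5.23: close targets have `f_W(t) ≥ 1/2`

Topic `Algebra/EuclideanLattices` (family `pqc`); serves the decomposition of Micciancio–Regev 2007,
Thm. 5.23 (`Literature.Computability.Cryptography.MicciancioRegev2007_gapCVP'_to_SIS'`). The reduction
of Thm. 5.23 runs the verifier `V(B, t, d, W)` of Aharonov–Regev [1] on a self-generated witness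
`W = [w₁, …, w_N] ⊆ L(B)*` and accepts iff (a) `wᵢ ∈ L(B)*`, (b) `f_W(t) = N⁻¹ ∑ᵢ cos(2π⟨t, wᵢ⟩) < 1/2`,
(c) the largest eigenvalue of `W Wᵀ` is at most `N/(2πd)²` (authors' version p. 28). Its YES-case
correctness is the **soundness of `V`** (p. 29, "for completeness, let us sketch the proof that `V`
outputs No whenever `dist(t, L(B)) ≤ d`"): if `dist(t, L(B)) ≤ d` and (a), (c) hold then
`f_W(t) ≥ 1/2`, so (b) fails. This file PROVES exactly that statement, for any family of dual vectors
in a real inner product space, with (c) in the quadratic-form form `∑ᵢ ⟨x, wᵢ⟩² ≤ N‖x‖²/(2πd)²` for all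
`x` (which is what "largest eigenvalue of `W Wᵀ` at most `N/(2πd)²`" means and how the proof uses it:
"`‖Wᵀx‖² ≤ N‖x‖²/(2πd)²` for any vector `x`"). Theorems only.

The tree's `ARVerifier.lean` proves soundness of a different, all-integer rendering of the verifier
(trace test, nearest-integer phases) for the coNP result of [1]; the present file is the real-number
test exactly as MR07 use it.

## Proof (as printed, p. 29)

Let `τ ∈ L` with `‖t - τ‖ ≤ d`. By (a), `f_W` is `L`-periodic, so `f_W(t) = f_W(t - τ)`; by
`cos x ≥ 1 - x²/2`, `f_W(t - τ) ≥ 1 - (2π²/N) ∑ᵢ ⟨t - τ, wᵢ⟩² ≥ 1 - (2π²/N) · N‖t - τ‖²/(2πd)² =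
1 - ‖t - τ‖²/(2d²) ≥ 1/2`.

## References

* D. Micciancio, O. Regev, *Worst-case to average-case reductions based on Gaussian measures*,
  SIAM J. Comput. 37 (2007) 267–302, proof of Thm. 5.23 (authors' version pp. 28–29).
* [1] D. Aharonov, O. Regev, *Lattice problems in NP ∩ coNP*, J. ACM 52 (2005) 749–765, §6.1.
-/

noncomputable section

open Metric Finset
open scoped Real InnerProductSpace

namespace Literature.Algebra.EuclideanLattices

variable {V : Type*} [NormedAddCommGroup V] [InnerProductSpace ℝ V]

/-- **`L`-periodicity of the witness cosines** (test (a) ⇒ `f_W` periodic modulo `L(B)`, MR07 p. 29):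
for `w ∈ L*` and `τ ∈ L`, `cos(2π⟨t - τ, w⟩) = cos(2π⟨t, w⟩)` (as `⟨τ, w⟩ ∈ ℤ`).
[cite: MicciancioRegev2007, Thm. 5.23 (proof, p. 29)] -/
theorem cos_two_pi_inner_sub_of_mem_dualLattice {L : Submodule ℤ V} {w τ : V} (hw : w ∈ dualLattice L)
    (hτ : τ ∈ L) (t : V) :
    Real.cos (2 * π * ⟪t - τ, w⟫_ℝ) = Real.cos (2 * π * ⟪t, w⟫_ℝ) := by
  obtain ⟨m, hm⟩ := mem_dualLattice.1 hw τ hτ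
  rw [inner_sub_left, real_inner_comm w τ, ← hm, mul_sub,
    show 2 * π * (m : ℝ) = (m : ℝ) * (2 * π) by ring, Real.cos_sub_int_mul_two_pi]

/-- **Soundness of the MR07/Aharonov–Regev witness test** (Micciancio–Regev 2007, proof of Thm. 5.23,
p. 29; Aharonov–Regev 2005 §6.1): let `w₁, …, w_N` (`N ≥ 1`) lie in the dual lattice `L*`, let
`d > 0`, and suppose the eigenvalue test (c) holds in the form `∑ᵢ ⟨x, wᵢ⟩² ≤ N‖x‖²/(2πd)²` for every
`x`. If some lattice vector `τ ∈ L` has `‖t - τ‖ ≤ d`, then `f_W(t) = N⁻¹ ∑ᵢ cos(2π⟨t, wᵢ⟩) ≥ 1/2`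
— test (b) fails and `V` outputs No. [cite: MicciancioRegev2007, Thm. 5.23 (proof, p. 29)] -/
theorem half_le_sum_cos_div_card_of_norm_sub_le {ι : Type*} [Fintype ι] [Nonempty ι] {L : Submodule ℤ V}
    {w : ι → V} (hw : ∀ i, w i ∈ dualLattice L) {t τ : V} (hτ : τ ∈ L) {d : ℝ} (hd : 0 < d)
    (htτ : ‖t - τ‖ ≤ d)
    (hW : ∀ x : V, ∑ i, ⟪x, w i⟫_ℝ ^ 2 ≤ Fintype.card ι * ‖x‖ ^ 2 / (2 * π * d) ^ 2) :
    1 / 2 ≤ (∑ i, Real.cos (2 * π * ⟪t, w i⟫_ℝ)) / Fintype.card ι := by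
  set N : ℝ := (Fintype.card ι : ℝ) with hN
  have hN0 : 0 < N := by rw [hN]; exact_mod_cast Fintype.card_pos
  -- periodicity and `cos x ≥ 1 - x²/2`
  have hcos : ∀ i, 1 - (2 * π * ⟪t - τ, w i⟫_ℝ) ^ 2 / 2 ≤ Real.cos (2 * π * ⟪t, w i⟫_ℝ) := fun i ↦ by
    rw [← cos_two_pi_inner_sub_of_mem_dualLattice (hw i) hτ t]
    exact Real.one_sub_sq_div_two_le_cos
  have hsum : N - 2 * π ^ 2 * ∑ i, ⟪t - τ, w i⟫_ℝ ^ 2 ≤ ∑ i, Real.cos (2 * π * ⟪t, w i⟫_ℝ) := by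
    calc N - 2 * π ^ 2 * ∑ i, ⟪t - τ, w i⟫_ℝ ^ 2 = ∑ i, (1 - (2 * π * ⟪t - τ, w i⟫_ℝ) ^ 2 / 2) := by
          rw [Finset.sum_sub_distrib, Finset.sum_const, Finset.card_univ, nsmul_eq_mul, mul_one, Finset.mul_sum]
          congr 1
          exact Finset.sum_congr rfl fun i _ ↦ by ring
      _ ≤ ∑ i, Real.cos (2 * π * ⟪t, w i⟫_ℝ) := Finset.sum_le_sum fun i _ ↦ hcos i
  -- the quadratic-form bound at `x = t - τ`
  have hq : ∑ i, ⟪t - τ, w i⟫_ℝ ^ 2 ≤ N * ‖t - τ‖ ^ 2 / (2 * π * d) ^ 2 := hW (t - τ)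
  have hq' : 2 * π ^ 2 * ∑ i, ⟪t - τ, w i⟫_ℝ ^ 2 ≤ N * ‖t - τ‖ ^ 2 / (2 * d ^ 2) := by
    calc 2 * π ^ 2 * ∑ i, ⟪t - τ, w i⟫_ℝ ^ 2 ≤ 2 * π ^ 2 * (N * ‖t - τ‖ ^ 2 / (2 * π * d) ^ 2) :=
          mul_le_mul_of_nonneg_left hq (by positivity)
      _ = N * ‖t - τ‖ ^ 2 / (2 * d ^ 2) := by field_simp
  have hdist : ‖t - τ‖ ^ 2 ≤ d ^ 2 := pow_le_pow_left₀ (norm_nonneg _) htτ 2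
  have hhalf : N * ‖t - τ‖ ^ 2 / (2 * d ^ 2) ≤ N / 2 := by
    rw [div_le_div_iff₀ (by positivity) (by positivity)]
    nlinarith
  rw [le_div_iff₀ hN0]
  linarith

/-- **Soundness of the witness test, distance form** (Micciancio–Regev 2007, proof of Thm. 5.23,
p. 29: "whenever `dist(t, L(B)) ≤ d` … `V(B, t, d, W)` outputs No"): for a discrete `L` in a
finite-dimensional space the distance `dist(t, L)` is attained, so `dist(t, L) ≤ d` gives the
conclusion of `half_le_sum_cos_div_card_of_norm_sub_le`. [cite: MicciancioRegev2007, Thm. 5.23 (proof, p. 29)] -/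
theorem half_le_sum_cos_div_card_of_infDist_le [FiniteDimensional ℝ V] {ι : Type*} [Fintype ι] [Nonempty ι]
    {L : Submodule ℤ V} [DiscreteTopology L] {w : ι → V} (hw : ∀ i, w i ∈ dualLattice L) {t : V} {d : ℝ}
    (hd : 0 < d) (hdist : infDist t (L : Set V) ≤ d)
    (hW : ∀ x : V, ∑ i, ⟪x, w i⟫_ℝ ^ 2 ≤ Fintype.card ι * ‖x‖ ^ 2 / (2 * π * d) ^ 2) :
    1 / 2 ≤ (∑ i, Real.cos (2 * π * ⟪t, w i⟫_ℝ)) / Fintype.card ι := by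
  have hclosed : IsClosed (X := V) L :=
    @AddSubgroup.isClosed_of_discrete _ _ _ _ _ L.toAddSubgroup (inferInstanceAs (DiscreteTopology L))
  obtain ⟨τ, hτ, hτd⟩ := hclosed.exists_infDist_eq_dist ⟨0, L.zero_mem⟩ t
  refine half_le_sum_cos_div_card_of_norm_sub_le hw hτ hd ?_ hW
  rw [← dist_eq_norm, ← hτd]
  exact hdist

end Literature.Algebra.EuclideanLattices

end
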